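import Summits.Ventures.PercRepro.RankLevelSetRuleQStaircaseMapsC
import Summits.Ventures.PercRepro.RankLevelSetRuleQSliceMapsModel

/-!
# PercRepro — THE EXACT THIN-SLICE MAP OF THE FAMILIES `k = 5 … 10` AT THE MATROID LEVEL (night-1, gen 19; dossier §30.9)

`rhat_thin_slice_iff` (RankLevelSetRuleQStaircaseMapsC) read on finite matroids through the swap bound `rhat_le_ruleQRecv`
(positive half) and the model matroid with its flat part, `modelRecvEq_flatPart` (negative half):
* **`ruleQ_thin_slice_iff`** — for `5 ≤ k ≤ 10` and `u ≤ 10`: «at the tight layer of EVERY finite matroid of the cell `(q+k, q)`,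
  EVERY member `Z` with `q − #(flatPart Z) = u` receives at least `Φ(q+k, q)` under Rule Q's equal split, for EVERY `q ≥ u`»
  holds if and only if `u ∉ [2, k − 3]`;
* **`ruleQ_thin_slice_iff_le_ten`** — the same for `2 ≤ k ≤ 10`, `u ≤ 10`: iff `k ≤ 4 ∨ u < 2 ∨ k − 2 ≤ u`.
Axioms: standard.
-/

namespace PercRepro

open Set Matroid

/-- **THE THIN-SLICE MAP AT THE MATROID LEVEL, EXACT, `5 ≤ k ≤ 10`, `u ≤ 10`**: Rule Q's equal split pays every member at
distance `u = q − #(flatPart Z)` from the top, at the tight layer of every finite matroid of every cell `(q+k, q)`, `q ≥ u`,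
if and only if `u ∉ [2, k − 3]`. -/
theorem ruleQ_thin_slice_iff (k u : ℕ) (hk5 : 5 ≤ k) (hk10 : k ≤ 10) (hu10 : u ≤ 10) :
    (∀ (β : Type) (M : Matroid β) (hf : M.Finite) (q : ℕ), u ≤ q → M.E.ncard = (q + k) + q →
        ∀ Z ∈ cellMembers M (q + k) q, (flatPart M Z).ncard = q - u →
          phiK (q + k) q ≤ @ruleQRecv β M hf (q + k) q Z)
      ↔ (u < 2 ∨ k - 2 ≤ u) := by
  constructor
  · intro h
    by_contra hu
    have h' := (rhat_thin_slice_iff k u hk5 hk10 hu10).not.2 hu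
    push Not at h'
    obtain ⟨q, hq, hlt⟩ := h'
    obtain ⟨β, M, hf, Z, hE, hZ, hP, hrecv⟩ := modelRecvEq_flatPart q k (q - u) (by omega) (Nat.sub_le q u)
    have h1 := h β M hf q hq hE Z hZ hP
    rw [hrecv] at h1
    exact absurd h1 (not_le.mpr hlt)
  · intro hu β M hf q hq hE Z hZ hP
    have h1 := (rhat_thin_slice_iff k u hk5 hk10 hu10).2 hu q hq
    have h2 := @rhat_le_ruleQRecv β M hf q k hE Z hZ
    rw [hP] at h2
    exact h1.trans h2

/-- **THE THIN-SLICE MAP AT THE MATROID LEVEL FOR EVERY FAMILY `2 ≤ k ≤ 10`, `u ≤ 10`**: paid for every `q` iff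
`k ≤ 4 ∨ u ≤ 1 ∨ u ≥ k − 2` (`rhat_slice_of_le_four` for `k ≤ 4`). -/
theorem ruleQ_thin_slice_iff_le_ten (k u : ℕ) (hk2 : 2 ≤ k) (hk10 : k ≤ 10) (hu10 : u ≤ 10) :
    (∀ (β : Type) (M : Matroid β) (hf : M.Finite) (q : ℕ), u ≤ q → M.E.ncard = (q + k) + q →
        ∀ Z ∈ cellMembers M (q + k) q, (flatPart M Z).ncard = q - u →
          phiK (q + k) q ≤ @ruleQRecv β M hf (q + k) q Z)
      ↔ (k ≤ 4 ∨ u < 2 ∨ k - 2 ≤ u) := by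
  rcases Nat.lt_or_ge k 5 with hlt | hge
  · refine ⟨fun _ => Or.inl (by omega), fun _ β M hf q hq hE Z hZ hP => ?_⟩
    have h1 := rhat_slice_of_le_four k u hk2 (by omega) q hq
    have h2 := @rhat_le_ruleQRecv β M hf q k hE Z hZ
    rw [hP] at h2
    exact h1.trans h2
  · rw [ruleQ_thin_slice_iff k u hge hk10 hu10]
    omega

end PercRepro
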